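import Summits.BirchSwinnertonDyer.Rank1Residual.F1Sign2.LevelZeroSpinLawNegDiscAtTwo
import HarnessLib.Audit.Tags
import HarnessLib

/-!
# DESC-41 «THE LEVEL-0 SWITCH AT AN ADDITIVE 2» — the isolation criterion, LAW 41, and the level-0 law with EVERY place decided (-desc g31, MEMO-desc §41; typer -ty g20)

PORT (typer -ty g20, cell bsd-f1-sign2) of -desc g31's `MEMO-desc-data/g31/lean/Sketch41.lean` e76c9dc2ea79a9d0 (MEMO-desc §41, memo 5e214351d3aa207b; rc 0 · 0 sorries · -desc BC7 3/3
CLEAN), as ONE file as the planner asked (imports the landed §40 module `LevelZeroSpinLawNegDiscAtTwo.lean`, p747664): VOCABULARY (`def`s with parameters, all over the §37/§39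
carriers): `NonIsolatedUnramifiedRootAtTwo F`, `NonIsolatedRootUnramifiedPairAtTwo F`, `AdditiveSwitchedOnAtTwo W F v`, `SwitchedOffSharpAt` / `SwitchedOnSharpAt` /
`RescuableSharpAt W c F v ℓ`; ROWS (`@[conjecture]`, conjecture-grade, theorem-candidates modulo LAW36′ exactly like DESC-39/40): **DESC-41-A** `PureSpinLawOfSwitchedOffSharpAtTwo`,
**DESC-41-B** `SpinObstructedOfTwoSwitchedOnSharpPlacesAtTwo`, **DESC-41-D** `LevelZeroSpinLawNegDiscSharpAtTwo` (= LAW 40 without the decidedness hypothesis); GLUE (10 theorems,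
proved): decidedness `switchedOffSharpAt_or_switchedOnSharpAt` (classical case split), `not_switchedOnSharpAt_of_off`, monotonicity `switchedOffSharpAt_of_switchedOffAt` /
`switchedOnSharpAt_of_switchedOnAt` / `rescuableSharpAt_of_rescuableAt`, `switchedOffSharpAt_iff_of_decided`, and the bridges `pureSpinLawOfSwitchedOff_of_sharp` (41-A ⟹
DESC-39-A), `spinObstructedOfTwoOn_of_sharp` (41-B ⟹ DESC-39-B), `levelZeroSpinLawNegDisc_of_sharp` (41-D ⟹ LAW 40 — an IMPLICATION carrying `h41`, not a proof of LAW 40: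
R268d / -desc's note; the audit tool's «proof-of-item» class is a reading artefact), `law41_twoOn_not_pure` — everything VERBATIM (body l.30–231), riders appended.

THE MATHEMATICS (-desc g31; REF1-audited): LEMMA 41.1 (integrality + vertical line at an additive `2`), THM 41.2 ISOLATION CRITERION (`T_Θ ∉ W⁰ ⟺ m(Θ) ≥ 5 ⟺ Θ/4` congruent to
another root — «Θ NOT ISOLATED»; proof: in origin coordinates `ψ₂/4 ≡ e³ + αe² + γ (mod 2)`, `f̄′ = x²`, so the only multiple root is the singular abscissa), LAW 41 = THM 38.2 ∘
THM 41.2 (point-free `u₂` at every additive type: `F = 1` types ON ⟺ some unramified root non-isolated; transvection types ON ⟺ `d₂ = 1`, pair unramified, rational root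
non-isolated; every other additive type OFF), box + census 41 016 / 41 016 place rows, two engines, 0 exceptions; the 10 census curves THM 39.1 left undecided are decided (III ×3,
III* ×5 ON; I₃* c4 ON; I₀* c2 OFF) in agreement with ENGINE 39 (10/10).

PORT GATE = REF1-AUDIT §268 (-ref1 g23, 2026-08-29T22:55:18Z; `REF1-data/b268/`: Probe268.lean 8d0d0afa246397ab 19/19 rc 0 · 0 warnings; law41_ref1.py = INDEPENDENT ENGINE C
from `amin` + `kod`/`c₂` only; consist268, score_ref1): **DESC-41-A / 41-B / 41-D SURVIVE (conjecture-grade as labelled); the six defs FAITHFUL to LAW 41; THM 41.2 proof CONFIRMED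
on paper with COR (i) sharpened (R268e: `F = 1` with three ℚ₂-roots ⟹ always ON, `14 ≤ v₂ disc F` automatic; `(4,4,4)` only with an unramified pair); ENGINE C: typed
`AdditiveSwitchedOnAtTwo` = `u_A` on 37 143 / 37 143 additive rows, THM 41.2 numerical 19 649 / 19 649, `k₂ = 2 ⟺` isolated root 1 052 / 1 052, §39-OFF ∧ LAW41-ON co-occurrence
0 / 37 143; frozen-prediction protocol sound (token part of the job INPUT label) and = REF1's rule-from-amin 55/55 (41t) · 82/82 (41v); independent re-scoring job41t 52/52
(rescued 18 · 725 · 0, visible 34 · 1 464 · 1 153), job41v 45/45 + 9 unknown NOT pure ⟹ 54/54, Lpos 23/23, UNEXPECTED 0 — every memo number reproduced exactly; 0 blocking.**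
Riders (none changes a row): **R268a** (`SwitchedOffSharpAt := SwitchedOffAt ∨ …` gives the §39 c-currency cells silent precedence over LAW 41's F-currency; they never conflict —
`c` and `F` generate the same cubic field and LAW 41's ON cells are disjoint from every §39 OFF disjunct; box 0 / 37 143; not a kernel fact), **R268b** (cosmetic:
`RescuableSharpAt`'s new disjunct carries no Kodaira restriction; it also holds at 136 box places of type I₀*/I_odd* c2 with profile (4,6,6), all sharp-OFF, never at a Vt-ON
place — no truth value changes inside 41-D), **R268c** (the `14 ≤ padicValInt 2 (cubicDiscZ F)` conjunct = «some pair of the three ℚ₂-roots congruent mod 8», additive `2`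
only), **R268d** (this port: `levelZeroSpinLawNegDisc_of_sharp` is an implication; `law41_twoOn_not_pure` and the monotonicity lemmas are audit-orphans by design), **R268e**
(COR (i) sharpened), **R268f** (for provers: `cubicDiscZ c < 0` in 41-D is LOAD-BEARING — dropping it is numerically contradicted by the `Δ_L > 0` profile-(6,8,8) curves V15n49p688,
V15n7p688, PURE with a lone sharp-ON non-rescuable place 2; `selmerTwoCard W = 1`, `DegOnePrimesOddClassC c` as in §259 — keep).  PARTITION none; beyond-print theorem
(kernel): no.  -desc §41.9 addendum (kit j336474): V1-d₂ = 2 rescue cell (4,8,8)/(4,10,10) CONFIRMED 18/18 PURE (first instances of `RescuableSharpAt`'s additive `d₂ = 2`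
disjunct), odd-`m` profiles 50/50 NOT pure, all-even triple coincidence (6,8,8)/(6,10,10) 9/9 NOT pure with `r₂ = 2` as 41-D reads; frozen claims 68/68; 0 LAW-41 violations
on 1 628 new curves.

REF2 PLACEMENT (-ref2 g58, 2026-08-29T22:33:37Z): (a) LEMMA 41.0 «`M_{2,v} = M_{1,v}^⊥`, hence upper-nice ⟺ lower-nice ⟺ nice at `v ∣ 2`»: COROLLARY-OF-PRINT, packaging
apparently NEW (ingredients: per factor `L_w`, `(𝓞_w^×/□)^⊥` = the unramified line under the Hilbert pairing = local class field theory; the Euler-characteristic count; Poonen–Rains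
2012 Prop 4.11; Yoo–Yu Lemma 4.3 — not stated in Yoo–Yu, not in BPT 2021, BK77 §3 unavailable; [cite: Kramer1981] treats only the quadratic-twist norm index and says «the situation
for cases of additive reduction seems to be more complicated»).  (b) THM 41.2 ISOLATION CRITERION: Tate-algorithm-level FOLKLORE in method, NO printed statement found ⟹ elementary
theorem, corollary-level (Tate's algorithm / Silverman ATAEC IV.9), keep the three-line proof in the docstring.  (c) LAW 41 = THM 38.2 ∘ THM 41.2: the niceness question at `v = 2`
that Brumer–Kramer / Kramer / BPT / Yoo–Yu leave open is ANSWERED by a complete additive-at-2 table in Hensel data `(e, m, v₂(disc F))` — NOVELTY (problem-relative)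
NEW-COMBINATION, the genuinely new reach; PROOF STATUS: paper proofs (THM 38.2, THM 41.2, 39.1 cells), REF1-audited (§246/§253/§268), NOT Lean-landed (the typed DESC-41 rows are
census-conjecture rows; LAW 41 as a theorem needs the tree's local Kummer map at 2) ⟹ REF2 column: LAW 41 (+ THM 38.1 + 39.1) = «BEYOND-PRINT THEOREM, PAPER-LEVEL (REF1 §268 has
now confirmed THM 41.2), NOT LANDED» — the first unconditional entry of that kind in this cell; desk wording for LEAD: «beyond-print theorem (kernel): none; beyond-print theorem
(paper, audited): LAW 41 niceness criterion at 2».  BSD not proved; 23715 not closed.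
-/

noncomputable section

open scoped Classical

open WeierstrassCurve Literature.NumberTheory.EllipticCurves Literature.NumberTheory.DiophantineGeometry Polynomial IsDedekindDomain NumberField

namespace Summit.BirchSwinnertonDyer.Rank1Residual.F1Sign2

/-! ### §41 vocabulary (all over the §37/§39 carriers) -/

/-- LAW 41's datum for the `F = 1` types: the integral 2-division cubic `F` has a root `Θ` in the maximal UNRAMIFIED extension of `ℚ₂` which is NOT ISOLATED,
`m(Θ) = v(F′(Θ)) ≥ 5`.  Point-free, in Hensel currency: `d₂ = 1` (one root `e`, `m = v₂(F′(e))` intrinsic): `m ≥ 5`, or the pair is unramified and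
`m_pair = (v₂(disc F) − m)/2 ≥ 5`; `d₂ = 2` (three roots, `disc F ∈ ℚ₂ˣ²`): some pair of roots congruent, i.e. `v₂(disc F) ≥ 14` (`v₂(disc F) = 12 + 2Σ_{i<j} v(e_i − e_j)`).
(RIDER, typer -ty g20: PLAIN `def` (LAW 41, `F = 1` types).  REF1-AUDIT §268: FAITHFUL; R268c: the `14 ≤ padicValInt 2 (cubicDiscZ F)` conjunct = «some pair of the three ℚ₂-roots
congruent mod 8» given `v(Θᵢ − Θⱼ) ≥ 2` (LEMMA 41.1 (a), additive `2` only — the def is used only under additive Kodaira types); R268e: COR (i) sharpened — `F = 1` with three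
ℚ₂-roots ⟹ always ON (`14 ≤ v₂ disc F` automatic there; `(4,4,4)` only with an unramified pair).  REF2 (22:33Z): THM 41.2 (isolation criterion) is Tate-algorithm-level
folklore in method with NO printed statement found — elementary, corollary-level.) -/
def NonIsolatedUnramifiedRootAtTwo (F : ℤ[X]) : Prop :=
  ∃ (e : ℤ) (m : ℕ), HenselDatumAtTwo F e m ∧
    (5 ≤ m ∨ (IsTwoAdicSquare (cubicDiscZ F) ∧ 14 ≤ padicValInt 2 (cubicDiscZ F)) ∨
      (IsTwoAdicUnramifiedNonsquare (cubicDiscZ F) ∧ m + 10 ≤ padicValInt 2 (cubicDiscZ F)))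

/-- LAW 41's datum for the TRANSVECTION types (`I_{2k}^*`, `c₂ = 2`: only the rational 2-torsion point can leave `𝒰₂`, THM 38.2): exactly one 2-adic root, the
pair UNRAMIFIED, and the rational root non-isolated (`m ≥ 5`). -/
def NonIsolatedRootUnramifiedPairAtTwo (F : ℤ[X]) : Prop :=
  ∃ (e : ℤ) (m : ℕ), HenselDatumAtTwo F e m ∧ IsTwoAdicUnramifiedNonsquare (cubicDiscZ F) ∧ 5 ≤ m

/-- LAW 41: the switched-ON cells at an ADDITIVE place `v ∣ 2` (`u₂ = 1`), by Kodaira symbol and local Tamagawa number: `III`, `III*`, `I_n^*` with `c = 4`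
(`F = 1` on `Φ[2] ≠ 0`) with a non-isolated unramified root; `I_n^*` (`n` even) with `c = 2` (transvection) with the rational root non-isolated and the pair unramified. -/
def AdditiveSwitchedOnAtTwo (W : WeierstrassCurve ℚ) (F : ℤ[X]) (v : HeightOneSpectrum (𝓞 ℚ)) : Prop :=
  ((W.kodairaSymbolAt v = KodairaSymbol.III ∨ W.kodairaSymbolAt v = KodairaSymbol.IIIstar ∨
      ∃ n : ℕ, W.kodairaSymbolAt v = KodairaSymbol.Istar n ∧ W.tamagawaNumberAt v = 4) ∧ NonIsolatedUnramifiedRootAtTwo F) ∨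
  ((∃ n : ℕ, W.kodairaSymbolAt v = KodairaSymbol.Istar n ∧ W.tamagawaNumberAt v = 2 ∧ Even n) ∧ NonIsolatedRootUnramifiedPairAtTwo F)

/-- THE SHARP LEVEL-0 SWITCH, OFF side: THM 39.1's OFF cells, or `v ∣ 2` not multiplicative and outside LAW 41's ON cells (every additive type not listed in
`AdditiveSwitchedOnAtTwo` — `II`, `IV`, `IV*`, `II*`, `I_odd^*` with `c = 2` — is OFF by THM 39.1 already: `c` odd or `Φ[2] = 0` or `F = −1`).
(RIDER, typer -ty g20: PLAIN `def`.  REF1-AUDIT §268 R268a: the first disjunct `SwitchedOffAt` (§39, c-currency: `HasLocalRootC`, `RamifiedPairC`, `ThreeLocalRootsC c ℓ`) takes silent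
precedence over LAW 41 (F-currency); the two never conflict because `c` and `F = twoDivisionCubicZ b₂ b₄ b₆` generate the same cubic field (root counts / pair types are field
invariants) and LAW 41's ON cells have `c₂ ∈ {2, 4}`, a root, and (Vt) `Even n`, unramified pair, `d₂ = 1` — disjoint from every §39 OFF disjunct (box: §39-OFF ∧ LAW41-ON
0 / 37 143); not a kernel fact (it needs the `CubicDatumFor` + `BInvariantsZ` semantics).) -/
def SwitchedOffSharpAt (W : WeierstrassCurve ℚ) (c F : ℤ[X]) (v : HeightOneSpectrum (𝓞 ℚ)) (ℓ : ℕ) : Prop :=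
  SwitchedOffAt W c v ℓ ∨ (ℓ = 2 ∧ ¬ W.HasMultiplicativeReductionAt v ∧ ¬ AdditiveSwitchedOnAtTwo W F v)

/-- THE SHARP LEVEL-0 SWITCH, ON side: not OFF by THM 39.1, and either THM 39.1's ON cells (`ℓ` odd, or `2` multiplicative) or LAW 41's ON cells at an additive `2`. -/
def SwitchedOnSharpAt (W : WeierstrassCurve ℚ) (c F : ℤ[X]) (v : HeightOneSpectrum (𝓞 ℚ)) (ℓ : ℕ) : Prop :=
  ¬ SwitchedOffAt W c v ℓ ∧ (ℓ ≠ 2 ∨ W.HasMultiplicativeReductionAt v ∨ AdditiveSwitchedOnAtTwo W F v)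

/-- RESCUABLE, sharp version: LAW 40's rescuable cells, plus THM 40.1's cell at a totally split ADDITIVE `2` (`d₂ = 2`): `k₂ = dim 𝒲₂ ∩ 𝒰₂ = 2` ⟺ some root is
isolated (`m = 4`; LAW 41 rank formula, 1 052 / 1 052 box rows) and `λ₂ = 0` ⟺ 𝔯 even above all three primes ⟺ every `m(Θ_i)` even (LEMMA 40.L).
(RIDER, typer -ty g20: PLAIN `def`.  REF1-AUDIT §268 R268b (cosmetic): the new additive disjunct carries no Kodaira restriction; it also holds at 136 box places of type I₀*/I_odd* c2 with
profile (4,6,6), all sharp-OFF, and never at a Vt-ON place (Probe268 K3) — so inside DESC-41-D (`SwitchedOffSharpAt v₀ ∨ RescuableSharpAt v₀`) no truth value changes.  -desc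
§41.9 addendum (kit j336474): the V1-`d₂ = 2` rescue cell (4,8,8)/(4,10,10) CONFIRMED 18/18 PURE — first instances of this disjunct.) -/
def RescuableSharpAt (W : WeierstrassCurve ℚ) (c F : ℤ[X]) (v : HeightOneSpectrum (𝓞 ℚ)) (ℓ : ℕ) : Prop :=
  RescuableAt W c F v ℓ ∨
    (ℓ = 2 ∧ ¬ W.HasMultiplicativeReductionAt v ∧ ¬ W.HasGoodReductionAt v ∧ IsTwoAdicSquare (cubicDiscZ F) ∧
      (∃ e : ℤ, HenselDatumAtTwo F e 4) ∧ ∀ (e : ℤ) (m : ℕ), HenselDatumAtTwo F e m → Even m)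

/-! ### §41 rows -/

/-- **DESC-41-A `PureSpinLawOfSwitchedOffSharpAtTwo` (THE LEVEL-0 LAW with every place decided, harmless direction; `@[conjecture]`, theorem-candidate modulo
LAW36′; MEMO-desc §41.4).**  Setting of LAW36 with the b-invariant cubic.  If EVERY place is switched off in the sharp sense (THM 39.1's cells at `ℓ` odd / `2`
good or multiplicative, LAW 41's cells at an additive `2`) then the PURE `S₃`-spin law fits.  Mechanism: `u_v = 0` everywhere (THM 39.1 + THM 41.2/LAW 41) ⟹ as
DESC-39-A.  Extends DESC-39-A by the additive-`2` OFF cells (`III` with `v₂(Δ) = 4`; `III*`, `I_odd^*` `c4` with ramified pair and `m = 4`; `I₀^*`/`I_{2k}^*` `c2`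
with unramified pair and `m = 4`).  BC5: LAW 41 box 41 016/41 016 (two engines); census: the formerly undecided `I₀*`-`c2` curve M1328I0sn7 is OFF and pure;
job41s arm P (spin side, pre-registered PREDICTIONS41S.md S41.1).  Why it might fail: LAW36′ dictionary; a mis-typed OFF cell at `2` would show as a `u₂ = 1` row
of job41 inside the cell (0 / 20 575 additive OFF rows).  Sources: MEMO-desc §38 (THM 38.2), §39, §41; Silverman AEC VII/App. C §15 (Tate's algorithm at 2);
PR12 arXiv:1104.2941 §4.
(RIDER, typer -ty g20: `@[conjecture]`, conjecture-grade, theorem-candidate modulo LAW36′ (= DESC-39-A with the sharp switches, every place decided; glue `pureSpinLawOfSwitchedOff_of_sharp` ⟹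
DESC-39-A).  REF1-AUDIT §268: **SURVIVES**; ENGINE C typed `AdditiveSwitchedOnAtTwo` = `u_A` 37 143 / 37 143; job41t/41v re-scored independently (rescued 18 · 725 pure primes · 0
failures).  REF2 (22:33Z): LAW 41 = NEW-COMBINATION reach of a print framework (Brumer–Kramer / [cite: Kramer1981] / BPT 2021 / Yoo–Yu 2022 leave niceness at an additive `2`
open).) -/
@[conjecture] def PureSpinLawOfSwitchedOffSharpAtTwo : Prop :=
  ∀ (W : WeierstrassCurve ℚ) [W.IsElliptic] [W.IsGloballyMinimal],
    ∀ (c xnum : ℤ[X]) (xden : ℕ) (B2 B4 B6 : ℤ), CubicDatumFor W c xnum xden → BInvariantsZ W B2 B4 B6 →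
      selmerTwoCard W = 1 → DegOnePrimesOddClassC c →
        (∀ (v : HeightOneSpectrum (𝓞 ℚ)) (ℓ : ℕ), PlaceOver v ℓ → SwitchedOffSharpAt W c (twoDivisionCubicZ B2 B4 B6) v ℓ) →
          CorrectedSpinLawFits W c xnum xden []

/-- **DESC-41-B `SpinObstructedOfTwoSwitchedOnSharpPlacesAtTwo` (THE COUNTING LAW with every place decided, visible direction; `@[conjecture]`,
theorem-candidate modulo LAW36′; MEMO-desc §41.4).**  Same setting, COMPLEX cubic field.  Two DISTINCT places switched on in the sharp sense ⟹ the pure law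
FAILS.  Mechanism = THM 39.2 verbatim (`u = 1` at two places, one norm-one unit class rescues at most one).  Extends DESC-39-B by the additive-`2` ON cells
(`III` with `v₂(Δ) ≥ 6` and a root; `III*`/`I_odd^*` `c4` with `m ≥ 5` or unramified pair or three roots; `I_{2k}^*` `c4` with a root; `I_{2k}^*` `c2` unramified
pair with `m ≥ 5`).  BC5: census — the 7 formerly undecided curves with an additive ON `2` and `Δ_L < 0` (R2n… `III` ×3, `III*` ×4) are 7/7 corrected
(g30 T40.4 intrinsic form, lone-visible: 𝔯 odd above 2, also DESC-37-A); job41s arm C (S41.2).  Why it might fail: as DESC-39-B; `Δ_L > 0` excluded on purpose.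
(RIDER, typer -ty g20: `@[conjecture]`, conjecture-grade, theorem-candidate modulo LAW36′ (= DESC-39-B with the sharp switches; glue `spinObstructedOfTwoOn_of_sharp` ⟹ DESC-39-B).
REF1-AUDIT §268: **SURVIVES** (job41t visible 34 · 1 464 · 1 153; job41v 45/45 + 9 unknown NOT pure ⟹ 54/54; UNEXPECTED 0).) -/
@[conjecture] def SpinObstructedOfTwoSwitchedOnSharpPlacesAtTwo : Prop :=
  ∀ (W : WeierstrassCurve ℚ) [W.IsElliptic] [W.IsGloballyMinimal],
    ∀ (c xnum : ℤ[X]) (xden : ℕ) (B2 B4 B6 : ℤ), CubicDatumFor W c xnum xden → BInvariantsZ W B2 B4 B6 →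
      selmerTwoCard W = 1 → DegOnePrimesOddClassC c → cubicDiscZ c < 0 →
        (∃ (v v' : HeightOneSpectrum (𝓞 ℚ)) (ℓ ℓ' : ℕ), v ≠ v' ∧ PlaceOver v ℓ ∧ PlaceOver v' ℓ' ∧
            SwitchedOnSharpAt W c (twoDivisionCubicZ B2 B4 B6) v ℓ ∧ SwitchedOnSharpAt W c (twoDivisionCubicZ B2 B4 B6) v' ℓ') →
          ¬ CorrectedSpinLawFits W c xnum xden []

/-- **DESC-41-D `LevelZeroSpinLawNegDiscSharpAtTwo` (LAW 40 WITHOUT THE DECIDEDNESS HYPOTHESIS; `@[conjecture]` — the complete LEVEL-0 law for complex cubic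
fields, `↔`; theorem-candidate modulo LAW36′; MEMO-desc §41.4).**  PURE ⟺ some place `v₀` has every other place switched off (sharp) and is itself switched
off (sharp) or rescuable (sharp).  On curves satisfying DESC-40-D's decidedness hypothesis it is DESC-40-D (glue `switchedOffSharpAt_iff_of_decided`); the new
content is the 10 census curves with an additive undecided `2` — **10/10** by g30 T40.4's intrinsic form joined with LAW 41 (lone `I₃*`-`c4`-`m = 6`: 𝔯 even,
rescued, pure; `III` ×3 / `III*` ×4 lone: 𝔯 odd, corrected; `III*` ramified `m = 7`: corrected; `I₀*`-`c2`-`m = 4`: OFF, pure) — and THM 40.1's rescue cell at an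
additive totally split `2` (0 census curves: a PREDICTION; job41s arm L).  Why it might fail: as DESC-40-D; the `d₂ = 2` additive rescue cell rests on the
LAW 41 rank formula `k₂ = 2 ⟺ ∃ isolated root` (box 1 052/1 052, not a proof).
(RIDER, typer -ty g20: `@[conjecture]` — DESC-41-D = LAW 40 WITHOUT the decidedness hypothesis (every place is decided by the sharp cells; glue `levelZeroSpinLawNegDisc_of_sharp` is an
IMPLICATION ⟹ LAW 40, R268d).  REF1-AUDIT §268: **SURVIVES**; R268f (for provers): `cubicDiscZ c < 0` is LOAD-BEARING — dropping it is numerically contradicted by the `Δ_L > 0`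
profile-(6,8,8) curves V15n49p688 `[0,−1,0,−145,−111]` and V15n7p688 `[0,−1,0,−177,−751]` (job41v Lpos: PURE, 10/10 and 8/8 pure primes, ENGINE 38 `rth₂ = 0`), whose lone place
2 is sharp-ON (V1, three roots) and NOT RescuableSharp — «contradicted», not «refuted» (prime counts < 30); `selmerTwoCard W = 1`, `DegOnePrimesOddClassC c` as in §259 — keep.
-desc §41.9 (kit j336474): all-even triple coincidence (6,8,8)/(6,10,10) 9/9 NOT pure with `r₂ = 2` exactly as this row reads; odd-`m` profiles 50/50 NOT pure; frozen claims
68/68; 0 LAW-41 violations on 1 628 new curves.  REF2 (22:33Z): REF2 column — LAW 41 (+ THM 38.1 + 39.1) = «BEYOND-PRINT THEOREM, PAPER-LEVEL (REF1-audited), NOT LANDED»;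
this typed row stays a census-conjecture row (LAW36′-side).) -/
@[conjecture] def LevelZeroSpinLawNegDiscSharpAtTwo : Prop :=
  ∀ (W : WeierstrassCurve ℚ) [W.IsElliptic] [W.IsGloballyMinimal],
    ∀ (c xnum : ℤ[X]) (xden : ℕ) (B2 B4 B6 : ℤ), CubicDatumFor W c xnum xden → BInvariantsZ W B2 B4 B6 →
      selmerTwoCard W = 1 → DegOnePrimesOddClassC c → cubicDiscZ c < 0 →
        (CorrectedSpinLawFits W c xnum xden [] ↔
          ∃ (v₀ : HeightOneSpectrum (𝓞 ℚ)) (ℓ₀ : ℕ), PlaceOver v₀ ℓ₀ ∧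
            (∀ (w : HeightOneSpectrum (𝓞 ℚ)) (ℓ : ℕ), PlaceOver w ℓ → w ≠ v₀ → SwitchedOffSharpAt W c (twoDivisionCubicZ B2 B4 B6) w ℓ) ∧
            (SwitchedOffSharpAt W c (twoDivisionCubicZ B2 B4 B6) v₀ ℓ₀ ∨ RescuableSharpAt W c (twoDivisionCubicZ B2 B4 B6) v₀ ℓ₀))

/-! ### kernel glue -/

/-- DECIDEDNESS (the point of §41): every place is switched off or on in the sharp sense. -/
theorem switchedOffSharpAt_or_switchedOnSharpAt (W : WeierstrassCurve ℚ) (c F : ℤ[X]) (v : HeightOneSpectrum (𝓞 ℚ)) (ℓ : ℕ) :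
    SwitchedOffSharpAt W c F v ℓ ∨ SwitchedOnSharpAt W c F v ℓ := by
  by_cases hoff : SwitchedOffAt W c v ℓ
  · exact Or.inl (Or.inl hoff)
  · by_cases h2 : ℓ = 2
    · by_cases hm : W.HasMultiplicativeReductionAt v
      · exact Or.inr ⟨hoff, Or.inr (Or.inl hm)⟩
      · by_cases ha : AdditiveSwitchedOnAtTwo W F v
        · exact Or.inr ⟨hoff, Or.inr (Or.inr ha)⟩
        · exact Or.inl (Or.inr ⟨h2, hm, ha⟩)
    · exact Or.inr ⟨hoff, Or.inl h2⟩

/-- EXCLUSIVITY: no place is both. -/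
theorem not_switchedOnSharpAt_of_off (W : WeierstrassCurve ℚ) (c F : ℤ[X]) (v : HeightOneSpectrum (𝓞 ℚ)) (ℓ : ℕ)
    (h : SwitchedOffSharpAt W c F v ℓ) : ¬ SwitchedOnSharpAt W c F v ℓ := by
  rintro ⟨hnoff, hon⟩
  rcases h with hoff | ⟨h2, hm, ha⟩
  · exact hnoff hoff
  · rcases hon with h | h | h
    · exact h h2
    · exact hm h
    · exact ha h

/-- Monotonicity: THM 39.1's OFF cells are sharp-OFF. -/
theorem switchedOffSharpAt_of_switchedOffAt (W : WeierstrassCurve ℚ) (c F : ℤ[X]) (v : HeightOneSpectrum (𝓞 ℚ)) (ℓ : ℕ)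
    (h : SwitchedOffAt W c v ℓ) : SwitchedOffSharpAt W c F v ℓ := Or.inl h

/-- Monotonicity: THM 39.1's ON cells are sharp-ON. -/
theorem switchedOnSharpAt_of_switchedOnAt (W : WeierstrassCurve ℚ) (c F : ℤ[X]) (v : HeightOneSpectrum (𝓞 ℚ)) (ℓ : ℕ)
    (h : SwitchedOnAt W c v ℓ) : SwitchedOnSharpAt W c F v ℓ := by
  rcases h with ⟨hnoff, h2 | hm⟩
  · exact ⟨hnoff, Or.inl h2⟩
  · exact ⟨hnoff, Or.inr (Or.inl hm)⟩

/-- Monotonicity: LAW 40's rescuable cells are sharp-rescuable. -/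
theorem rescuableSharpAt_of_rescuableAt (W : WeierstrassCurve ℚ) (c F : ℤ[X]) (v : HeightOneSpectrum (𝓞 ℚ)) (ℓ : ℕ)
    (h : RescuableAt W c F v ℓ) : RescuableSharpAt W c F v ℓ := Or.inl h

/-- On a place decided in the §39 sense, sharp-OFF is THM 39.1's OFF. -/
theorem switchedOffSharpAt_iff_of_decided (W : WeierstrassCurve ℚ) (c F : ℤ[X]) (v : HeightOneSpectrum (𝓞 ℚ)) (ℓ : ℕ)
    (hdec : SwitchedOffAt W c v ℓ ∨ SwitchedOnAt W c v ℓ) : SwitchedOffSharpAt W c F v ℓ ↔ SwitchedOffAt W c v ℓ := by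
  constructor
  · rintro (hoff | ⟨h2, hm, -⟩)
    · exact hoff
    · rcases hdec with hoff | ⟨hnoff, h | h⟩
      · exact hoff
      · exact absurd h2 h
      · exact absurd h hm
  · exact fun h => Or.inl h

/-- **DESC-41-A supersedes DESC-39-A** (b-invariant form): all places OFF (§39) ⟹ all places sharp-OFF ⟹ pure. -/
theorem pureSpinLawOfSwitchedOff_of_sharp (h41 : PureSpinLawOfSwitchedOffSharpAtTwo)
    (W : WeierstrassCurve ℚ) [W.IsElliptic] [W.IsGloballyMinimal] (c xnum : ℤ[X]) (xden : ℕ) (B2 B4 B6 : ℤ)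
    (hc : CubicDatumFor W c xnum xden) (hb : BInvariantsZ W B2 B4 B6) (hs : selmerTwoCard W = 1) (ho : DegOnePrimesOddClassC c)
    (hoff : ∀ (v : HeightOneSpectrum (𝓞 ℚ)) (ℓ : ℕ), PlaceOver v ℓ → SwitchedOffAt W c v ℓ) :
    CorrectedSpinLawFits W c xnum xden [] :=
  h41 W c xnum xden B2 B4 B6 hc hb hs ho (fun v ℓ hv => Or.inl (hoff v ℓ hv))

/-- **DESC-41-B contains DESC-39-B** (b-invariant form): two §39-ON places are two sharp-ON places. -/
theorem spinObstructedOfTwoOn_of_sharp (h41 : SpinObstructedOfTwoSwitchedOnSharpPlacesAtTwo)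
    (W : WeierstrassCurve ℚ) [W.IsElliptic] [W.IsGloballyMinimal] (c xnum : ℤ[X]) (xden : ℕ) (B2 B4 B6 : ℤ)
    (hc : CubicDatumFor W c xnum xden) (hb : BInvariantsZ W B2 B4 B6) (hs : selmerTwoCard W = 1) (ho : DegOnePrimesOddClassC c) (hneg : cubicDiscZ c < 0)
    (htwo : ∃ (v v' : HeightOneSpectrum (𝓞 ℚ)) (ℓ ℓ' : ℕ), v ≠ v' ∧ PlaceOver v ℓ ∧ PlaceOver v' ℓ' ∧ SwitchedOnAt W c v ℓ ∧ SwitchedOnAt W c v' ℓ') :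
    ¬ CorrectedSpinLawFits W c xnum xden [] := by
  obtain ⟨v, v', ℓ, ℓ', hne, hv, hv', hon, hon'⟩ := htwo
  exact h41 W c xnum xden B2 B4 B6 hc hb hs ho hneg
    ⟨v, v', ℓ, ℓ', hne, hv, hv', switchedOnSharpAt_of_switchedOnAt W c _ v ℓ hon, switchedOnSharpAt_of_switchedOnAt W c _ v' ℓ' hon'⟩

/-- **DESC-41-D ⟹ DESC-40-D**: on curves satisfying LAW 40's decidedness hypothesis the sharp law is LAW 40 (sharp-OFF = OFF at every place; at the lone place
the extra rescue cell needs a non-multiplicative non-good `2`, impossible when `2` is decided and ON, irrelevant when it is OFF). -/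
theorem levelZeroSpinLawNegDisc_of_sharp (h41 : LevelZeroSpinLawNegDiscSharpAtTwo) : LevelZeroSpinLawNegDiscAtTwo := by
  intro W _ _ c xnum xden B2 B4 B6 hc hb hs ho hneg hdec
  have key := h41 W c xnum xden B2 B4 B6 hc hb hs ho hneg
  rw [key]
  constructor
  · rintro ⟨v₀, ℓ₀, hv₀, hoth, hcase⟩
    refine ⟨v₀, ℓ₀, hv₀, fun w ℓ hw hne => (switchedOffSharpAt_iff_of_decided W c _ w ℓ (hdec w ℓ hw)).mp (hoth w ℓ hw hne), ?_⟩
    rcases hcase with hoff | hresc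
    · exact Or.inl ((switchedOffSharpAt_iff_of_decided W c _ v₀ ℓ₀ (hdec v₀ ℓ₀ hv₀)).mp hoff)
    · rcases hresc with hr | ⟨h2, hm, hgood, -⟩
      · exact Or.inr hr
      · rcases hdec v₀ ℓ₀ hv₀ with hoff | ⟨-, h | h⟩
        · exact Or.inl hoff
        · exact absurd h2 h
        · exact absurd h hm
  · rintro ⟨v₀, ℓ₀, hv₀, hoth, hcase⟩
    refine ⟨v₀, ℓ₀, hv₀, fun w ℓ hw hne => Or.inl (hoth w ℓ hw hne), ?_⟩
    rcases hcase with hoff | hresc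
    · exact Or.inl (Or.inl hoff)
    · exact Or.inr (Or.inl hresc)

/-- Under DESC-41-D, two distinct sharp-ON places forbid the pure law (DESC-41-B is a consequence of the `↔`). -/
theorem law41_twoOn_not_pure (hlaw : LevelZeroSpinLawNegDiscSharpAtTwo)
    (W : WeierstrassCurve ℚ) [W.IsElliptic] [W.IsGloballyMinimal] (c xnum : ℤ[X]) (xden : ℕ) (B2 B4 B6 : ℤ)
    (hc : CubicDatumFor W c xnum xden) (hb : BInvariantsZ W B2 B4 B6) (hs : selmerTwoCard W = 1) (ho : DegOnePrimesOddClassC c) (hneg : cubicDiscZ c < 0)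
    (htwo : ∃ (v v' : HeightOneSpectrum (𝓞 ℚ)) (ℓ ℓ' : ℕ), v ≠ v' ∧ PlaceOver v ℓ ∧ PlaceOver v' ℓ' ∧
      SwitchedOnSharpAt W c (twoDivisionCubicZ B2 B4 B6) v ℓ ∧ SwitchedOnSharpAt W c (twoDivisionCubicZ B2 B4 B6) v' ℓ') :
    ¬ CorrectedSpinLawFits W c xnum xden [] := by
  intro hpure
  obtain ⟨v₀, ℓ₀, -, hoff, -⟩ := (hlaw W c xnum xden B2 B4 B6 hc hb hs ho hneg).mp hpure
  obtain ⟨v, v', ℓ, ℓ', hne, hv, hv', hon, hon'⟩ := htwo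
  by_cases h : v = v₀
  · exact not_switchedOnSharpAt_of_off W c _ v' ℓ' (hoff v' ℓ' hv' (fun h' => hne (h.trans h'.symm))) hon'
  · exact not_switchedOnSharpAt_of_off W c _ v ℓ (hoff v ℓ hv h) hon

end Summit.BirchSwinnertonDyer.Rank1Residual.F1Sign2

end
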